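import Summits.KontsevichZagierPeriods.Zeta5Search.Barrier.ConeGammaCuspPeriodConeCertificate

/-!
# ζ(5) search — BARRIER: THE JUNCTION-COUNT GAUGE — with unit marginal spread the wall bound is the number of junctions on the wall

HONEST FRAMING (cell `pub-zeta5`): systematic search; no irrationality claim unless kernel-certified. MODEL objects
under Brown–Zudilin's (28)+(30) accounting ([BZ22] = arXiv:2210.03391; (28) observed, not proved); nothing here is a
statement about `ζ(5)`, any `γ` of record, the cone's supremum (C2 OPEN) or the value / sign of the cusp slope at a named
direction; the UNIT MARGINAL SPREAD of the junction pattern functions is a HYPOTHESIS (`hspread`) — for REALISABLE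
prefixes it is P2 g31's theorem `junction_greedy_weight_bounds` (junction greedy weights are simple flips), for the
non-realisable («virtual») patterns through which `F` is extended it is a property of the chosen extension, checked on
samples at the desk (DATA), never asserted here; S-E stays CONJECTURED; records in print UNMOVED. Prover P2 g32, item
«THE WALL-WEIGHTED GAUGE» (INBOX 2026-08-27), file (4): the per-wall defect bounds `Λ` of files (2)–(3) made EXPLICIT.

* **`period_defect_abs_le_junctionCount`** — if at every junction `m` any two marginals of the same member form differ
  by at most `1` (`hspread`; implied by oriented unit marginals `f m (S+k) − f m S ∈ [0,1]` on `F`, `[−1,0]` off `F`), then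
  for `k ≠ l ∉ S`: `|F(S+k) + F(S+l) − F(S) − F(S+k+l)| ≤ J_{kl} := #{m : k ∈ M m ∧ l ∈ M m}` — the number of junctions on
  the wall (P2 g31's `period_defect_eq_sum_junction_defects`: the period defect pools the junction defects, each a
  difference of two marginals of `k`);
* **`cuspSlope_le_greedy_add_countGauge`** / **`greedy_sub_countGauge_le_cuspSlope`** — hence files (2)'s bounds with the
  EXPLICIT weights `J`: `|σ(δ) − G_{δ₀}(δ)| ≤ Σ_{walls inverted between δ₀ and δ} J_{kl}·|r_k(δ) − r_l(δ)|` — no defect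
  bound to supply, only the member finsets of the period;
* **`cuspSlope_nonpos_on_cone_of_generators_count`** — file (3)'s no-ascent cone certificate with the weights `J`
  (`J ≥ 0` automatically): a certificate needs the chamber weights of `δ₀` (29 prefix values of `F` along `δ₀`'s local
  line), the member finsets, and the rates of the generators — nothing sampled.
DESK (DATA, `HOME/pub-zeta5-p2/g32/alg/countgauge.py`, exact): oriented unit marginals of the cell's virtual extension
(P2 g11's Hamiltonian-path value) hold on every sampled (junction, prefix, form); `Σ J` versus the sampled `Σ Λ̂⁺` and
`378·Λ̂_F`, and the `J`-certified no-ascent cone radii — in the README. NOT here: any `J`, gauge or `σ` at a named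
direction; the covering computation; `γ`, C2, S-E, `ζ(5)`.
-/

noncomputable section

open Set MeasureTheory Finset
open scoped Topology

namespace Summit.KontsevichZagierPeriods.Zeta5Search.Barrier.ConeGamma

/-! ### The period defect is bounded by the number of junctions on the wall -/

/-- **UNIT MARGINAL SPREAD ⇒ |WALL DEFECT| ≤ #JUNCTIONS ON THE WALL.** For `F(A) = Σ_{m<N} f m (A ∩ M m)`: if at every
junction any two marginals of the same member form differ by at most `1`
(`|(f m (S+k) − f m S) − (f m (S'+k) − f m S')| ≤ 1` for `S, S' ⊆ M m`, `k ∈ M m ∖ (S ∪ S')`), then for `k ∉ S`, `l ≠ k`: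
`|F(S+k) + F(S+l) − F(S) − F(S+k+l)| ≤ #{m < N : k ∈ M m ∧ l ∈ M m}`. -/
theorem period_defect_abs_le_junctionCount {N : ℕ} {M : ℕ → Finset (Fin 28)} {f : ℕ → Finset (Fin 28) → ℝ}
    {F : Finset (Fin 28) → ℝ} (hF : ∀ A, F A = ∑ m ∈ Finset.range N, f m (A ∩ M m))
    (hspread : ∀ m ∈ Finset.range N, ∀ S S' : Finset (Fin 28), S ⊆ M m → S' ⊆ M m → ∀ k ∈ M m, k ∉ S → k ∉ S' →
      |(f m (insert k S) - f m S) - (f m (insert k S') - f m S')| ≤ 1)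
    {S : Finset (Fin 28)} {k l : Fin 28} (hkS : k ∉ S) (hkl : k ≠ l) :
    |F (insert k S) + F (insert l S) - F S - F (insert k (insert l S))| ≤
      (((Finset.range N).filter fun m => k ∈ M m ∧ l ∈ M m).card : ℝ) := by
  classical
  rw [period_defect_eq_sum_junction_defects hF S k l]
  refine (Finset.abs_sum_le_sum_abs _ _).trans ?_
  have h1 : ∀ m ∈ (Finset.range N).filter (fun m => k ∈ M m ∧ l ∈ M m),
      |f m (insert k (S ∩ M m)) + f m (insert l (S ∩ M m)) - f m (S ∩ M m) -
        f m (insert k (insert l (S ∩ M m)))| ≤ 1 := by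
    intro m hm
    obtain ⟨hmN, hk, hl⟩ := Finset.mem_filter.mp hm
    have e : f m (insert k (S ∩ M m)) + f m (insert l (S ∩ M m)) - f m (S ∩ M m) -
        f m (insert k (insert l (S ∩ M m))) =
        (f m (insert k (S ∩ M m)) - f m (S ∩ M m)) -
          (f m (insert k (insert l (S ∩ M m))) - f m (insert l (S ∩ M m))) := by ring
    rw [e]
    refine hspread m hmN (S ∩ M m) (insert l (S ∩ M m)) Finset.inter_subset_right
      (Finset.insert_subset hl Finset.inter_subset_right) k hk
      (fun h => hkS (Finset.mem_inter.mp h).1) ?_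
    intro h
    rcases Finset.mem_insert.mp h with h | h
    · exact hkl h
    · exact hkS (Finset.mem_inter.mp h).1
  refine (Finset.sum_le_sum h1).trans ?_
  rw [Finset.sum_const, nsmul_eq_mul, mul_one]

/-! ### The wall-weighted bounds with the explicit junction counts -/

/-- **THE JUNCTION-COUNT OFF-CHAMBER BOUND, UPPER SIDE.** With the data of `cuspSlope_eq_lovasz_period` and unit
marginal spread at every junction of the period: for every generic `δ₀` and every `δ`,
`cuspSlope a T δ ≤ G_{δ₀}(δ) + Σ_{ρ₀ k<ρ₀ l} J_{kl}·max(r_k(δ) − r_l(δ), 0)`, `J_{kl} = #{m : k ∈ M m ∧ l ∈ M m}`. -/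
theorem cuspSlope_le_greedy_add_countGauge {a : Dir} (hpos : ∀ k, 0 < h28 a k) {T : ℝ} (hT : 0 < T)
    (hper : ∀ k : Fin 28, ∃ z : ℤ, T * h28 a k = z)
    {M : ℕ → Finset (Fin 28)} {f : ℕ → Finset (Fin 28) → ℝ}
    (hf : ∀ m, m + 1 < (bkpts a T).card → ∀ Δ : Fin 8 → ℝ, (∀ k, |phiForm Δ k| < 1) →
      (∀ k, |phiForm Δ k| < wallDist a T) →
        (torusN (bkpt a T m • sParam a + Δ) : ℝ) = f m ((M m).filter fun k => 0 ≤ phiForm Δ k))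
    {F : Finset (Fin 28) → ℝ} (hF : ∀ A, F A = ∑ m ∈ Finset.range ((bkpts a T).card - 1), f m (A ∩ M m))
    (hspread : ∀ m ∈ Finset.range ((bkpts a T).card - 1), ∀ S S' : Finset (Fin 28), S ⊆ M m → S' ⊆ M m →
      ∀ k ∈ M m, k ∉ S → k ∉ S' → |(f m (insert k S) - f m S) - (f m (insert k S') - f m S')| ≤ 1)
    {δ₀ : Fin 8 → ℝ} (hgen : ∀ k l : Fin 28, k ≠ l → phiForm δ₀ k / h28 a k ≠ phiForm δ₀ l / h28 a l)
    (δ : Fin 8 → ℝ) :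
    cuspSlope a T δ ≤
      ∑ k, (F (Finset.univ.filter fun l => phiForm δ₀ k / h28 a k ≤ phiForm δ₀ l / h28 a l) -
          F (Finset.univ.filter fun l => phiForm δ₀ k / h28 a k < phiForm δ₀ l / h28 a l)) *
        (phiForm δ k / h28 a k) +
      ∑ k, ∑ l, if phiForm δ₀ k / h28 a k < phiForm δ₀ l / h28 a l then
        ((((Finset.range ((bkpts a T).card - 1)).filter fun m => k ∈ M m ∧ l ∈ M m).card : ℝ)) *
          max (phiForm δ k / h28 a k - phiForm δ l / h28 a l) 0 else 0 :=
  cuspSlope_le_greedy_add_wallGauge hpos hT hper hf hF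
    (Λ := fun k l => (((Finset.range ((bkpts a T).card - 1)).filter fun m => k ∈ M m ∧ l ∈ M m).card : ℝ))
    (fun _ _ _ hkS _ hkl => (le_abs_self _).trans (period_defect_abs_le_junctionCount hF hspread hkS hkl))
    hgen δ

/-- **THE JUNCTION-COUNT OFF-CHAMBER BOUND, LOWER SIDE**:
`G_{δ₀}(δ) − Σ_{ρ₀ k<ρ₀ l} J_{kl}·max(r_k(δ) − r_l(δ), 0) ≤ cuspSlope a T δ`. -/
theorem greedy_sub_countGauge_le_cuspSlope {a : Dir} (hpos : ∀ k, 0 < h28 a k) {T : ℝ} (hT : 0 < T)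
    (hper : ∀ k : Fin 28, ∃ z : ℤ, T * h28 a k = z)
    {M : ℕ → Finset (Fin 28)} {f : ℕ → Finset (Fin 28) → ℝ}
    (hf : ∀ m, m + 1 < (bkpts a T).card → ∀ Δ : Fin 8 → ℝ, (∀ k, |phiForm Δ k| < 1) →
      (∀ k, |phiForm Δ k| < wallDist a T) →
        (torusN (bkpt a T m • sParam a + Δ) : ℝ) = f m ((M m).filter fun k => 0 ≤ phiForm Δ k))
    {F : Finset (Fin 28) → ℝ} (hF : ∀ A, F A = ∑ m ∈ Finset.range ((bkpts a T).card - 1), f m (A ∩ M m))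
    (hspread : ∀ m ∈ Finset.range ((bkpts a T).card - 1), ∀ S S' : Finset (Fin 28), S ⊆ M m → S' ⊆ M m →
      ∀ k ∈ M m, k ∉ S → k ∉ S' → |(f m (insert k S) - f m S) - (f m (insert k S') - f m S')| ≤ 1)
    {δ₀ : Fin 8 → ℝ} (hgen : ∀ k l : Fin 28, k ≠ l → phiForm δ₀ k / h28 a k ≠ phiForm δ₀ l / h28 a l)
    (δ : Fin 8 → ℝ) :
    ∑ k, (F (Finset.univ.filter fun l => phiForm δ₀ k / h28 a k ≤ phiForm δ₀ l / h28 a l) -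
          F (Finset.univ.filter fun l => phiForm δ₀ k / h28 a k < phiForm δ₀ l / h28 a l)) *
        (phiForm δ k / h28 a k) -
      ∑ k, ∑ l, (if phiForm δ₀ k / h28 a k < phiForm δ₀ l / h28 a l then
        ((((Finset.range ((bkpts a T).card - 1)).filter fun m => k ∈ M m ∧ l ∈ M m).card : ℝ)) *
          max (phiForm δ k / h28 a k - phiForm δ l / h28 a l) 0 else 0) ≤
      cuspSlope a T δ :=
  greedy_sub_wallGauge_le_cuspSlope hpos hT hper hf hF
    (Λ := fun k l => (((Finset.range ((bkpts a T).card - 1)).filter fun m => k ∈ M m ∧ l ∈ M m).card : ℝ))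
    (fun _ _ _ hkS _ hkl => (neg_abs_le _).trans' (neg_le_neg
      (period_defect_abs_le_junctionCount hF hspread hkS hkl)))
    hgen δ

/-! ### The no-ascent cone certificate with the junction counts -/

/-- **A NO-ASCENT CONE WITH THE EXPLICIT WEIGHTS.** With unit marginal spread, a generic reference `δ₀` and finitely
many generators `g_j` at which the junction-count majorant is `≤ 0`:
`cuspSlope a T (Σ_{j∈s} t_j • g_j) ≤ 0` for every `t ≥ 0` (file (3) with `Λ = J ≥ 0`). -/
theorem cuspSlope_nonpos_on_cone_of_generators_count {a : Dir} (hpos : ∀ k, 0 < h28 a k) {T : ℝ} (hT : 0 < T)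
    (hper : ∀ k : Fin 28, ∃ z : ℤ, T * h28 a k = z)
    {M : ℕ → Finset (Fin 28)} {f : ℕ → Finset (Fin 28) → ℝ}
    (hf : ∀ m, m + 1 < (bkpts a T).card → ∀ Δ : Fin 8 → ℝ, (∀ k, |phiForm Δ k| < 1) →
      (∀ k, |phiForm Δ k| < wallDist a T) →
        (torusN (bkpt a T m • sParam a + Δ) : ℝ) = f m ((M m).filter fun k => 0 ≤ phiForm Δ k))
    {F : Finset (Fin 28) → ℝ} (hF : ∀ A, F A = ∑ m ∈ Finset.range ((bkpts a T).card - 1), f m (A ∩ M m))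
    (hspread : ∀ m ∈ Finset.range ((bkpts a T).card - 1), ∀ S S' : Finset (Fin 28), S ⊆ M m → S' ⊆ M m →
      ∀ k ∈ M m, k ∉ S → k ∉ S' → |(f m (insert k S) - f m S) - (f m (insert k S') - f m S')| ≤ 1)
    {δ₀ : Fin 8 → ℝ} (hgen : ∀ k l : Fin 28, k ≠ l → phiForm δ₀ k / h28 a k ≠ phiForm δ₀ l / h28 a l)
    {ι : Type*} (s : Finset ι) (g : ι → Fin 8 → ℝ)
    (hcert : ∀ j ∈ s,
      ∑ k, (F (Finset.univ.filter fun l => phiForm δ₀ k / h28 a k ≤ phiForm δ₀ l / h28 a l) -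
          F (Finset.univ.filter fun l => phiForm δ₀ k / h28 a k < phiForm δ₀ l / h28 a l)) *
        (phiForm (g j) k / h28 a k) +
      ∑ k, ∑ l, (if phiForm δ₀ k / h28 a k < phiForm δ₀ l / h28 a l then
        ((((Finset.range ((bkpts a T).card - 1)).filter fun m => k ∈ M m ∧ l ∈ M m).card : ℝ)) *
          max (phiForm (g j) k / h28 a k - phiForm (g j) l / h28 a l) 0 else 0) ≤ 0)
    (t : ι → ℝ) (ht : ∀ j ∈ s, 0 ≤ t j) :
    cuspSlope a T (∑ j ∈ s, t j • g j) ≤ 0 :=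
  cuspSlope_nonpos_on_cone_of_generators hpos hT hper hf hF
    (Λ := fun k l => (((Finset.range ((bkpts a T).card - 1)).filter fun m => k ∈ M m ∧ l ∈ M m).card : ℝ))
    (fun _ _ => Nat.cast_nonneg _)
    (fun _ _ _ hkS _ hkl => (le_abs_self _).trans (period_defect_abs_le_junctionCount hF hspread hkS hkl))
    hgen s g hcert t ht

/-- **REALISABLE PREFIXES HAVE ORIENTED UNIT MARGINALS** (P2 g31's `junction_greedy_weight_bounds`, restated as the
spread it implies): at a junction `b ∈ bkpts a T` with pattern data `M, f` (`hf`), for any two references `δ₀, δ₀'`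
generic on all 28 forms and every form `k`, the two greedy weights of `k` (marginals of `k` behind the two prefix sets)
differ by at most `1`. So `hspread` above HOLDS on every pair of realisable prefixes; on the virtual patterns it is a
property of the extension (hypothesis). -/
theorem junction_greedy_weight_spread_le_one {a : Dir} (hpos : ∀ k, 0 < h28 a k) {T b : ℝ} (hb : b ∈ bkpts a T)
    {M : Finset (Fin 28)} {f : Finset (Fin 28) → ℝ}
    (hf : ∀ Δ : Fin 8 → ℝ, (∀ k, |phiForm Δ k| < 1) → (∀ k, |phiForm Δ k| < wallDist a T) →
      (torusN (b • sParam a + Δ) : ℝ) = f (M.filter fun k => 0 ≤ phiForm Δ k))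
    {δ₀ δ₀' : Fin 8 → ℝ} (hgen : ∀ k l : Fin 28, k ≠ l → phiForm δ₀ k / h28 a k ≠ phiForm δ₀ l / h28 a l)
    (hgen' : ∀ k l : Fin 28, k ≠ l → phiForm δ₀' k / h28 a k ≠ phiForm δ₀' l / h28 a l) (k : Fin 28) :
    |(f (M.filter fun l => phiForm δ₀ k / h28 a k ≤ phiForm δ₀ l / h28 a l) -
        f (M.filter fun l => phiForm δ₀ k / h28 a k < phiForm δ₀ l / h28 a l)) -
      (f (M.filter fun l => phiForm δ₀' k / h28 a k ≤ phiForm δ₀' l / h28 a l) -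
        f (M.filter fun l => phiForm δ₀' k / h28 a k < phiForm δ₀' l / h28 a l))| ≤ 1 := by
  obtain ⟨h1, h2⟩ := junction_greedy_weight_bounds hpos hb hf hgen k
  obtain ⟨h1', h2'⟩ := junction_greedy_weight_bounds hpos hb hf hgen' k
  rw [abs_le]
  by_cases hk : k ∈ FIdx
  · obtain ⟨a1, a2⟩ := h1 hk
    obtain ⟨b1, b2⟩ := h1' hk
    constructor <;> linarith
  · obtain ⟨a1, a2⟩ := h2 hk
    obtain ⟨b1, b2⟩ := h2' hk
    constructor <;> linarith

end Summit.KontsevichZagierPeriods.Zeta5Search.Barrier.ConeGamma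

end
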